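import Summits.Ventures.Crystal3D.Theorems.StickyWulffConstantGenericWallFloorStackLedgerLocalWordTwo
import Summits.Ventures.Crystal3D.Theorems.StickyWulffConstantGenericWallFloorStackLedgerLocalWordFarTwo
import Summits.Ventures.Crystal3D.Theorems.StickyWulffConstantGenericWallFloorStarPairFar
import HarnessLib

/-!
# `GenericWallFloor` per pair under the two level-two word criteria, with `StarPairCoaxial` discharged from the
# certified `StarPairFar` (crux `GenericWallFloor`, line `WallLedgerG`)

HONEST FRAMING. Part of the venture `Summits/Ventures/Crystal3D` (cell `crystal3d-full`), helper `--supports` the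
crux `GenericWallFloor` (stmt-Ventures-19480) of `route-Ventures-StickyWulffConstant`, registered line `WallLedgerG`,
open stub `stub_twoSlabAdhesion` (general fillings).  Companion of 19480-p1's `…GenericWallFloorAtOfFar`
(`genericWallFloorAt_nonChain/_irrational/_chain/_word_of_far`): the same one-line discharge
`starPairCoaxial_of_far` (`…StarPairFar`, lit g13's / wulff-p2 g10's certified exact B&B as the named hypothesis
`StarPairFar`) applied to the level-two criteria `genericWallFloorAt_wordTwo_of_star` (near ray allowed one step;
`…StackLedgerLocalWordTwo`) and `genericWallFloorAt_wordFarTwo_of_star` (far ray allowed one step;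
`…StackLedgerLocalWordFarTwo`).  Remaining named inputs: exactly `ExactOnly`(C12-55) [P₅, E1] and `StarPairFar`
[certified ×2 lineages; admissible, ROUTE.md §84(xii)].

WHAT THIS IS NOT: not the crux — the ray-aligned core `l + c ≥ k − 1` and the two named inputs remain; F-C1 not moved.
-/

noncomputable section

namespace Summit.Ventures.Crystal3D.Theorems

open Summit.Ventures.Crystal3D Finset
open Literature.MathematicalPhysics.StatisticalMechanics (fccStacking barlowStacking IsHaggSeq contactDeficiency)
open scoped InnerProductSpace

open scoped Classical in
/-- **`GenericWallFloor` for every chain pair under the level-two word criterion**, modulo `ExactOnly`(C12-55) and the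
CERTIFIED `StarPairFar`. -/
theorem genericWallFloorAt_wordTwo_of_far
    {s₀ : EuclideanSpace ℝ (Fin 3)} (hs₀ : s₀ ∈ fccSlots)
    (hcert : ExactOnly 0 (fccSlots.filter fun w => 0 < ⟪w, s₀⟫_ℝ))
    (hfar : StarPairFar)
    (A₁ : EuclideanSpace ℝ (Fin 3) ≃ₗᵢ[ℝ] EuclideanSpace ℝ (Fin 3)) (t₁ : EuclideanSpace ℝ (Fin 3))
    (A₂ : EuclideanSpace ℝ (Fin 3) ≃ₗᵢ[ℝ] EuclideanSpace ℝ (Fin 3)) (t₂ : EuclideanSpace ℝ (Fin 3))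
    {u₁ : EuclideanSpace ℝ (Fin 3)} (hu₁ : u₁ ∈ fccSlots)
    (hsteep₁ : Real.sqrt 2 / 2 ≤ ⟪A₁ u₁, EuclideanSpace.single (2 : Fin 3) (1 : ℝ)⟫_ℝ)
    {u₂ : EuclideanSpace ℝ (Fin 3)} (hu₂ : u₂ ∈ fccSlots)
    (hsteep₂ : ⟪A₂ u₂, EuclideanSpace.single (2 : Fin 3) (1 : ℝ)⟫_ℝ ≤ -(Real.sqrt 2 / 2))
    (κ₀ : List (EuclideanSpace ℝ (Fin 3))) (μ₂ μ₁ : EuclideanSpace ℝ (Fin 3)) (hκ₀ : κ₀ ≠ [])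
    (hκl : ∀ μ ∈ κ₀ ++ [μ₂, μ₁], ‖μ‖ = 1 ∧
      ∀ w ∈ fccSlots, ⟪w, μ⟫_ℝ = 0 ∨ ⟪w, μ⟫_ℝ = Real.sqrt (2 / 3) ∨ ⟪w, μ⟫_ℝ = -Real.sqrt (2 / 3))
    (hκc : List.IsChain (fun μ μ' => ⟪μ, μ'⟫_ℝ = 1 / 3 ∨ ⟪μ, μ'⟫_ℝ = -1 / 3) (κ₀ ++ [μ₂, μ₁]))
    (hA₂ : A₂ '' fccStacking 1 (Real.sqrt (2 / 3)) = (wordFrame A₁ (κ₀ ++ [μ₂, μ₁])) '' fccStacking 1 (Real.sqrt (2 / 3)))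
    (hsecond : ∀ n₁ : EuclideanSpace ℝ (Fin 3), (n₁ = A₁ μ₁ ∨ n₁ = -A₁ μ₁) → ⟪A₁ u₁, n₁⟫_ℝ = Real.sqrt (2 / 3) →
      ∀ q ∈ fccSlots, 0 < ⟪twinFrame A₁ n₁ q, n₁⟫_ℝ →
        (∀ q' ∈ fccSlots, 0 < ⟪twinFrame A₁ n₁ q', n₁⟫_ℝ →
          ⟪twinFrame A₁ n₁ q', EuclideanSpace.single (2 : Fin 3) (1 : ℝ)⟫_ℝ ≤
            ⟪twinFrame A₁ n₁ q, EuclideanSpace.single (2 : Fin 3) (1 : ℝ)⟫_ℝ) →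
        (twinFrame A₁ n₁).symm ((2 * Real.sqrt (2 / 3)) • twinFrame A₁ n₁ q - n₁) ≠ μ₂ ∧
        (twinFrame A₁ n₁).symm ((2 * Real.sqrt (2 / 3)) • twinFrame A₁ n₁ q - n₁) ≠ -μ₂)
    (hlast : ∀ μ, (κ₀ ++ [μ₂, μ₁]).head? = some μ → ⟪A₂ u₂, wordFrame A₁ (κ₀ ++ [μ₂, μ₁]) μ⟫_ℝ = 0) :
    GenericWallFloorAt A₁ t₁ A₂ t₂ :=
  genericWallFloorAt_wordTwo_of_star hs₀ hcert (starPairCoaxial_of_far hfar) A₁ t₁ A₂ t₂ hu₁ hsteep₁ hu₂ hsteep₂ κ₀ μ₂ μ₁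
    hκ₀ hκl hκc hA₂ hsecond hlast

open scoped Classical in
/-- **`GenericWallFloor` for every chain pair under the word criterion with the far ray allowed one step**, modulo
`ExactOnly`(C12-55) and the CERTIFIED `StarPairFar`. -/
theorem genericWallFloorAt_wordFarTwo_of_far
    {s₀ : EuclideanSpace ℝ (Fin 3)} (hs₀ : s₀ ∈ fccSlots)
    (hcert : ExactOnly 0 (fccSlots.filter fun w => 0 < ⟪w, s₀⟫_ℝ))
    (hfar : StarPairFar)
    (A₁ : EuclideanSpace ℝ (Fin 3) ≃ₗᵢ[ℝ] EuclideanSpace ℝ (Fin 3)) (t₁ : EuclideanSpace ℝ (Fin 3))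
    (A₂ : EuclideanSpace ℝ (Fin 3) ≃ₗᵢ[ℝ] EuclideanSpace ℝ (Fin 3)) (t₂ : EuclideanSpace ℝ (Fin 3))
    {u₁ : EuclideanSpace ℝ (Fin 3)} (hu₁ : u₁ ∈ fccSlots)
    (hsteep₁ : Real.sqrt 2 / 2 ≤ ⟪A₁ u₁, EuclideanSpace.single (2 : Fin 3) (1 : ℝ)⟫_ℝ)
    {u₂ : EuclideanSpace ℝ (Fin 3)} (hu₂ : u₂ ∈ fccSlots)
    (hsteep₂ : ⟪A₂ u₂, EuclideanSpace.single (2 : Fin 3) (1 : ℝ)⟫_ℝ ≤ -(Real.sqrt 2 / 2))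
    (μk μk1 : EuclideanSpace ℝ (Fin 3)) (κ₁ : List (EuclideanSpace ℝ (Fin 3))) (hκ₁ : κ₁ ≠ [])
    (hκl : ∀ μ ∈ μk :: μk1 :: κ₁, ‖μ‖ = 1 ∧
      ∀ w ∈ fccSlots, ⟪w, μ⟫_ℝ = 0 ∨ ⟪w, μ⟫_ℝ = Real.sqrt (2 / 3) ∨ ⟪w, μ⟫_ℝ = -Real.sqrt (2 / 3))
    (hκc : List.IsChain (fun μ μ' => ⟪μ, μ'⟫_ℝ = 1 / 3 ∨ ⟪μ, μ'⟫_ℝ = -1 / 3) (μk :: μk1 :: κ₁))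
    (hA₂ : A₂ '' fccStacking 1 (Real.sqrt (2 / 3)) =
      (wordFrame A₁ (μk :: μk1 :: κ₁)) '' fccStacking 1 (Real.sqrt (2 / 3)))
    (hfirst : ∀ μ, κ₁.getLast? = some μ → ⟪u₁, μ⟫_ℝ = 0)
    (hsecond : ∀ n₁ : EuclideanSpace ℝ (Fin 3),
      (n₁ = wordFrame A₁ (μk :: μk1 :: κ₁) μk ∨ n₁ = -wordFrame A₁ (μk :: μk1 :: κ₁) μk) →
      ⟪A₂ u₂, n₁⟫_ℝ = Real.sqrt (2 / 3) →
      ∀ q ∈ fccSlots, 0 < ⟪twinFrame A₂ n₁ q, n₁⟫_ℝ →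
        (∀ q' ∈ fccSlots, 0 < ⟪twinFrame A₂ n₁ q', n₁⟫_ℝ →
          ⟪twinFrame A₂ n₁ q', -EuclideanSpace.single (2 : Fin 3) (1 : ℝ)⟫_ℝ ≤
            ⟪twinFrame A₂ n₁ q, -EuclideanSpace.single (2 : Fin 3) (1 : ℝ)⟫_ℝ) →
        (wordFrame A₁ (μk :: μk1 :: κ₁)).symm
            (A₂ ((twinFrame A₂ n₁).symm ((2 * Real.sqrt (2 / 3)) • twinFrame A₂ n₁ q - n₁))) ≠ μk1 ∧
        (wordFrame A₁ (μk :: μk1 :: κ₁)).symm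
            (A₂ ((twinFrame A₂ n₁).symm ((2 * Real.sqrt (2 / 3)) • twinFrame A₂ n₁ q - n₁))) ≠ -μk1) :
    GenericWallFloorAt A₁ t₁ A₂ t₂ :=
  genericWallFloorAt_wordFarTwo_of_star hs₀ hcert (starPairCoaxial_of_far hfar) A₁ t₁ A₂ t₂ hu₁ hsteep₁ hu₂ hsteep₂ μk μk1 κ₁
    hκ₁ hκl hκc hA₂ hfirst hsecond

end Summit.Ventures.Crystal3D.Theorems

end
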